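import Summits.QuantumFields.YangMills.Theorems.FemtoTransferGapPhysL2Infinite
import Summits.QuantumFields.YangMills.Theorems.LuscherReductionRunningReductionKTDoor
import Literature.Analysis.OperatorTheory.CompactCompression
import Literature.Analysis.OperatorTheory.CompactPositiveMinMaxLevels

/-!
# SPECTRAL ATTAINMENT at fixed lattice: physical, `l2`-orthonormal exact eigenfunctions of the zero-flux transfer operator
# realising the min–max transfer values `levelValue` (`(ℤ/L)³`, `SU(2)`, `β ≥ 0`)

Fleet-service module of seat ym-infvol-p2 g4 (route `LuscherReduction`, crux RED `stmt-QuantumFields-19978`, line «KTR»): step 3 (last) of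
the bridge between the tree's min–max numbers `levelValue su2Rep L β k` (`Theorems/FemtoTransferGapLevels.lean`: `inf` over `k` physical
constraint functions of `sup` of constrained Rayleigh quotients — defined WITHOUT any operator theory) and the compact-operator layer of
`Literature/Analysis/OperatorTheory/` (`PositiveKernelTransferOperator`, `CompactCompression`, `CompactPositiveMinMaxLevels`).

**Main theorem `exists_isPhys_eigenfamily`**: for `0 ≤ β` and every `k` with `0 < levelValue su2Rep L β k` there are PHYSICAL zero-flux test
functions `φ₀, …, φ_k`, `l2`-orthonormal, with `transferApply β (φ j) = levelValue su2Rep L β j • φ j` POINTWISE.  So the docstring of `levelValue`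
(«for the positive, self-adjoint, Hilbert–Schmidt zero-flux transfer operator this is its `k`-th largest eigenvalue counted with multiplicity») is
now a theorem, and the hypothesis `hatt` of the KTR non-vacuity certificate (`KTRCalibration.dressedRitz_of_runningReduction`, p492709) is
discharged wherever `λ_k > 0` (in the femto window this follows from RED ∧ ONE: `Theorems/LuscherReductionRunningReductionKTRCertificate.lean`).
(This module is route-independent: no `Theses` import.)
APPENDED: `exists_isPhys_eigenfamily_dominating` — the same family with the DOMINATION clause (Courant–Fischer equality case): physical `ψ ⊥ φ_{<j}`
have `⟨ψ,K_βψ⟩ ≤ λ_j‖ψ‖²`.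

Proof: `A` = the `L²` kernel operator of `K_β` (step 1), compressed to the complete, `A`-invariant, infinite-dimensional (step 2) physical closed
subspace `V = physL2 L` (Lit `exists_compression`: self-adjoint, compact; positive by step 1); Lit `exists_orthonormal_eigenvectors_antitone`
gives orthonormal eigenvectors `e_j ∈ V` with antitone eigenvalues `ev_j` dominating the Rayleigh quotient off `e_{<j}`; Lit
`isGLB_minmax_of_dense_constraints` over the dense core of physical classes (§7) identifies `ev_j` as a GLB which §8 matches with the tree's
`sInf`/`sSup` definition of `levelValue` (both junk conventions — `sSup ∅ = 0`, unbounded `sInf` — handled by `0 ≤ ev_j`); the representatives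
are `φ_j = ev_j⁻¹ ∫ K_β(·,V) e_j(V) dV` (step 1 `isPhys_transferApply_coe`), whose class is `e_j` and which satisfy the eigen-equation everywhere.

HONEST FRAMING: fixed-lattice functional analysis (Reed–Simon I Thm. VI.16, IV Thm. XIII.1–2) over tree objects; femto rung R2b1
infrastructure; no renormalisation-group content; nothing here bears on infinite volume, the continuum limit or the Clay gap.
-/

set_option autoImplicit false

noncomputable section

open MeasureTheory Filter Topology Real
open Literature.MathematicalPhysics.QuantumFieldTheory
open Literature.MathematicalPhysics.QuantumLattice
open Literature.Analysis.OperatorTheory.YMMatrixModel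
open Literature.Analysis.OperatorTheory
open scoped InnerProductSpace BigOperators

namespace Summit.QuantumFields.YangMills.Theorems.FemtoTransferGap.PhysL2

open Summit.QuantumFields.YangMills.Theorems.FemtoTransferGap

variable {L : ℕ} [NeZero L]

/-! ## §7 The dense physical core inside the physical closed subspace -/

variable (L) in
/-- The physical core seen inside the physical closed subspace. [cite: ReedSimonIV1978, Thm. XIII.2] -/
def physCoreIn : Submodule ℝ (physL2 L) := (physCore L).comap (physL2 L).subtype

/-- Membership in `physCoreIn`. [folklore] -/
theorem mem_physCoreIn_iff {x : physL2 L} : x ∈ physCoreIn L ↔ (x : Lp ℝ 2 (configMeasure SU2 L)) ∈ physCore L := Iff.rfl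

/-- **The core is dense in the physical closed subspace** (by construction: the latter is the closure of the former). [cite: ReedSimonIV1978, Thm. XIII.2] -/
theorem dense_physCoreIn : Dense (physCoreIn L : Set (physL2 L)) := by
  rw [Subtype.dense_iff]
  intro v hv
  have hv' : v ∈ closure (physCore L : Set (Lp ℝ 2 (configMeasure SU2 L))) := by rw [← coe_physL2]; exact hv
  refine closure_mono ?_ hv'
  intro w hw
  exact ⟨⟨w, physCore_le_physL2 hw⟩, (mem_physCoreIn_iff).mpr hw, rfl⟩

/-! ## §8 Spectral attainment -/

/-- A physical trial function's `L²` class, as an element of the physical closed subspace. [folklore] -/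
def toV (ψ : physSubmodule L) : physL2 L := ⟨toL2 ψ, toL2_mem_physL2 ψ⟩

/-- The underlying class of `toV ψ` is `toL2 ψ`. [folklore] -/
@[simp] theorem coe_toV (ψ : physSubmodule L) : ((toV ψ : physL2 L) : Lp ℝ 2 (configMeasure SU2 L)) = toL2 ψ := rfl

/-- `toV ψ` lies in the core. [folklore] -/
theorem toV_mem_physCoreIn (ψ : physSubmodule L) : toV ψ ∈ physCoreIn L := by
  rw [mem_physCoreIn_iff, coe_toV]
  exact toL2_mem_physCore ψ

set_option maxHeartbeats 800000 in
/-- **SPECTRAL ATTAINMENT at fixed lattice.**  For `β ≥ 0` and every level `k` with `λ_k(β,L) > 0` there is a PHYSICAL,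
`l2`-ORTHONORMAL family `φ₀, …, φ_k` of EXACT eigenfunctions of the zero-flux transfer operator realising the min–max values:
`K_β φ_j = λ_j φ_j` pointwise, `λ_j = levelValue su2Rep L β j`.  Proof: Hilbert–Schmidt theorem + min–max over the dense physical core
(Lit `exists_orthonormal_eigenvectors_antitone`, `isGLB_minmax_of_dense_constraints`) for the compression (Lit `exists_compression`) of
the `L²` kernel operator to the (infinite-dimensional, `not_finiteDimensional_physL2`) physical closed subspace; the eigenvalues are
identified with the tree's `levelValue` (Courant–Fischer in `rayleighSet` form, junk values `sSup ∅ = 0` included); the representatives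
are the kernel integrals `λ_j⁻¹ ∫ K_β(·,V) e_j(V) dV` (`isPhys_transferApply_coe`). [cite: ReedSimonI1980, Thm. VI.16] [cite: ReedSimonIV1978, Thm. XIII.1–2] -/
theorem exists_isPhys_eigenfamily {β : ℝ} (hβ : 0 ≤ β) (k : ℕ) (hk : 0 < levelValue su2Rep L β k) :
    ∃ φ : Fin (k + 1) → (GaugeConfig 3 L SU2 → ℝ),
      (∀ i, IsPhys (φ i)) ∧
      (∀ i l, l2 (φ i) (φ l) = if i = l then 1 else 0) ∧
      (∀ i, transferApply β (φ i) = levelValue su2Rep L β i • φ i) := by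
  classical
  -- the `L²` operator, its compression to the physical closed subspace `V`
  obtain ⟨A, hA, hsa, hc⟩ := exists_transferOpL2 (L := L) β
  haveI : CompleteSpace (physL2 L) := isClosed_physL2.completeSpace_coe
  obtain ⟨T, hT, hTsa, hTc⟩ := exists_compression A (physL2 L) (fun v hv => apply_mem_physL2 hA hv)
  have hTsa' : IsSelfAdjoint T := hTsa hsa
  have hTc' : IsCompactOperator T := hTc hc
  have hTinner : ∀ x : physL2 L, ⟪x, T x⟫_ℝ = ⟪(x : Lp ℝ 2 (configMeasure SU2 L)), A x⟫_ℝ := fun x =>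
    (compression_inner_norm hT x).1
  have hpos : ∀ x : physL2 L, 0 ≤ RCLike.re ⟪x, T x⟫_ℝ := fun x => by
    rw [RCLike.re_to_real, hTinner]
    exact inner_apply_nonneg hA hβ x.2
  have hsym : ∀ x y : physL2 L, ⟪T x, y⟫_ℝ = ⟪x, T y⟫_ℝ := fun x y =>
    (ContinuousLinearMap.isSelfAdjoint_iff_isSymmetric.1 hTsa') x y
  -- the eigenfamily and the min–max principle over the dense core
  obtain ⟨e, ev, hon, heig, hanti, hdom⟩ :=
    exists_orthonormal_eigenvectors_antitone (𝕜 := ℝ) not_finiteDimensional_physL2 hTsa' hTc' hpos (k + 1)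
  have heig' : ∀ j, T (e j) = ev j • e j := fun j => by simpa using heig j
  have hAe : ∀ j, A (e j : Lp ℝ 2 (configMeasure SU2 L)) = ev j • (e j : Lp ℝ 2 (configMeasure SU2 L)) := fun j => by
    rw [← hT, heig', Submodule.coe_smul]
  have hglb := fun j : Fin (k + 1) =>
    isGLB_minmax_of_dense_constraints (𝕜 := ℝ) hsym hpos hon heig hanti hdom (physCoreIn L) dense_physCoreIn j
  -- dictionary on the core
  have hcoreT : ∀ ψ : physSubmodule L, ⟪toV ψ, T (toV ψ)⟫_ℝ = qform su2Rep β (ψ : GaugeConfig 3 L SU2 → ℝ) ψ := fun ψ => by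
    rw [hTinner]; exact inner_apply_toL2 hA ψ ψ
  have hcoreN : ∀ ψ : physSubmodule L, ‖toV ψ‖ ^ 2 = l2 (ψ : GaugeConfig 3 L SU2 → ℝ) ψ := fun ψ => by
    rw [Submodule.coe_norm]; exact norm_sq_toL2 ψ
  have hcoreI : ∀ ψ φ : physSubmodule L, ⟪toV ψ, toV φ⟫_ℝ = l2 (ψ : GaugeConfig 3 L SU2 → ℝ) φ := fun ψ φ => by
    rw [Submodule.coe_inner]; exact inner_toL2 ψ φ
  -- IDENTIFICATION `ev j = levelValue j`
  have hev : ∀ j : Fin (k + 1), ev j = levelValue su2Rep L β j := by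
    intro j
    apply le_antisymm
    · -- `ev j ≤ levelValue j`: every constraint family's constrained supremum is admissible
      unfold levelValue
      refine le_csInf ⟨_, fun _ _ => (1 : ℝ), fun _ => isPhys_const 1, rfl⟩ ?_
      rintro s ⟨φs, hφ, rfl⟩
      refine (hglb j).1 ⟨fun l => toV ⟨φs l, hφ l⟩, fun l => toV_mem_physCoreIn _, fun x hx hperp => ?_⟩
      obtain ⟨ψ, hψx⟩ := mem_physCore_iff.mp (mem_physCoreIn_iff.mp hx)
      have hxψ : x = toV ψ := Subtype.ext hψx.symm
      subst hxψ
      rw [RCLike.re_to_real, hcoreT, hcoreN]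
      have hperp' : ∀ l, l2 (ψ : GaugeConfig 3 L SU2 → ℝ) (φs l) = 0 := fun l => by
        have h := hperp l
        rw [hcoreI] at h
        rw [l2_comm]
        exact h
      rcases (l2_self_nonneg (ψ : GaugeConfig 3 L SU2 → ℝ)).eq_or_lt with h0 | hpos'
      · rw [← h0, mul_zero, qform_eq_zero_of_l2_eq_zero β (isPhys_coe ψ) h0.symm]
      · have hmem : qform su2Rep β (ψ : GaugeConfig 3 L SU2 → ℝ) ψ / l2 (ψ : GaugeConfig 3 L SU2 → ℝ) ψ ∈
            rayleighSet su2Rep L β (fun χ => ∀ i, l2 χ (φs i) = 0) := ⟨ψ, isPhys_coe ψ, hperp', hpos', rfl⟩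
        have hle := le_csSup (bddAbove_rayleighSet su2Rep continuous_su2Rep β _) hmem
        rwa [div_le_iff₀ hpos'] at hle
    · -- `levelValue j ≤ ev j`: admissible values with core constraints approach `ev j`
      refine le_of_forall_pos_lt_add fun ε hε => ?_
      obtain ⟨s, ⟨χ, hχD, hχ⟩, -, hslt⟩ := (hglb j).exists_between (lt_add_of_pos_right _ hε)
      have hχψ : ∀ l, ∃ ψ : physSubmodule L, toV ψ = χ l := fun l => by
        obtain ⟨ψ, hψ⟩ := mem_physCore_iff.mp (mem_physCoreIn_iff.mp (hχD l))
        exact ⟨ψ, Subtype.ext hψ⟩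
      choose ψs hψs using hχψ
      have hφ : ∀ l, IsPhys ((ψs l : physSubmodule L) : GaugeConfig 3 L SU2 → ℝ) := fun l => isPhys_coe _
      have h1 : levelValue su2Rep L β j ≤ sSup (rayleighSet su2Rep L β fun χ' => ∀ i, l2 χ' ((ψs i : physSubmodule L) : _) = 0) := by
        unfold levelValue
        refine csInf_le ⟨0, ?_⟩ ⟨fun i => ((ψs i : physSubmodule L) : GaugeConfig 3 L SU2 → ℝ), hφ, rfl⟩
        rintro t ⟨φs', -, rfl⟩
        refine Real.sSup_nonneg ?_
        rintro r ⟨ψ', hψ', -, hp, rfl⟩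
        exact div_nonneg (qform_su2Rep_self_nonneg hβ hψ') hp.le
      have h2 : sSup (rayleighSet su2Rep L β fun χ' => ∀ i, l2 χ' ((ψs i : physSubmodule L) : _) = 0) ≤ max s 0 := by
        refine Real.sSup_le ?_ (le_max_right _ _)
        rintro r ⟨ψ', hψ', hperp, hp, rfl⟩
        refine (le_max_left s 0).trans' ?_
        rw [div_le_iff₀ hp]
        have hx : toV ⟨ψ', hψ'⟩ ∈ physCoreIn L := toV_mem_physCoreIn _
        have hperpV : ∀ l, ⟪χ l, toV ⟨ψ', hψ'⟩⟫_ℝ = 0 := fun l => by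
          rw [← hψs l, hcoreI, l2_comm]; exact hperp l
        have h := hχ (toV ⟨ψ', hψ'⟩) hx hperpV
        rwa [RCLike.re_to_real, hcoreT, hcoreN] at h
      have h3 : max s 0 < ev j + ε := max_lt hslt (lt_add_of_le_of_pos (ev_nonneg hpos hon heig j) hε)
      linarith
  -- positivity of the first `k+1` eigenvalues
  have hevpos : ∀ j : Fin (k + 1), 0 < ev j := fun j => by
    have h1 : ev (Fin.last k) ≤ ev j := hanti (Fin.le_last j)
    have h2 : ev (Fin.last k) = levelValue su2Rep L β k := by rw [hev, Fin.val_last]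
    rw [h2] at h1
    exact hk.trans_le h1
  -- REPRESENTATIVES: `φ_j := ev_j⁻¹ • K_β e_j`
  set φ : Fin (k + 1) → (GaugeConfig 3 L SU2 → ℝ) := fun j =>
    (ev j)⁻¹ • transferApply β ((e j : Lp ℝ 2 (configMeasure SU2 L)) : GaugeConfig 3 L SU2 → ℝ) with hφdef
  have hKe : ∀ j, IsPhys (transferApply β ((e j : Lp ℝ 2 (configMeasure SU2 L)) : GaugeConfig 3 L SU2 → ℝ)) := fun j =>
    isPhys_transferApply_coe β (e j).2
  have hφphys : ∀ j, IsPhys (φ j) := fun j => (hKe j).smul _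
  -- the class of `φ_j` is `e_j`
  have hclass : ∀ j, toL2 ⟨φ j, hφphys j⟩ = (e j : Lp ℝ 2 (configMeasure SU2 L)) := fun j => by
    have h1 : (⟨φ j, hφphys j⟩ : physSubmodule L) = (ev j)⁻¹ • ⟨_, hKe j⟩ := rfl
    rw [h1, map_smul, toL2_transferApply_coe hA (e j).2, hAe, smul_smul, inv_mul_cancel₀ (hevpos j).ne', one_smul]
  refine ⟨φ, hφphys, fun i l => ?_, fun i => ?_⟩
  · -- orthonormality
    rw [show l2 (φ i) (φ l) = l2 ((⟨φ i, hφphys i⟩ : physSubmodule L) : GaugeConfig 3 L SU2 → ℝ) (⟨φ l, hφphys l⟩ : physSubmodule L)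
      from rfl, ← inner_toL2, hclass, hclass, ← Submodule.coe_inner]
    exact (orthonormal_iff_ite.mp hon) i l
  · -- the eigen-equation, pointwise
    have hae : transferApply β ((e i : Lp ℝ 2 (configMeasure SU2 L)) : GaugeConfig 3 L SU2 → ℝ) =ᵐ[configMeasure SU2 L]
        ev i • ((e i : Lp ℝ 2 (configMeasure SU2 L)) : GaugeConfig 3 L SU2 → ℝ) := by
      have h1 := hA (e i : Lp ℝ 2 (configMeasure SU2 L))
      rw [hAe] at h1
      filter_upwards [h1, Lp.coeFn_smul (ev i) (e i : Lp ℝ 2 (configMeasure SU2 L))] with U hU hs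
      rw [transferApply_apply, ← hU, hs]
    have hKK : transferApply β (transferApply β ((e i : Lp ℝ 2 (configMeasure SU2 L)) : GaugeConfig 3 L SU2 → ℝ)) =
        ev i • transferApply β ((e i : Lp ℝ 2 (configMeasure SU2 L)) : GaugeConfig 3 L SU2 → ℝ) := by
      rw [transferApply_congr_ae hae, transferApply_smul]
    rw [← hev]
    show transferApply β ((ev i)⁻¹ • transferApply β _) = ev i • ((ev i)⁻¹ • transferApply β _)
    rw [transferApply_smul, hKK, smul_smul, smul_smul, inv_mul_cancel₀ (hevpos i).ne', mul_inv_cancel₀ (hevpos i).ne']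


set_option maxHeartbeats 800000 in
/-- **SPECTRAL ATTAINMENT WITH DOMINATION (appended; Courant–Fischer equality case).**  As `exists_isPhys_eigenfamily`, and moreover the exact
eigenfamily is an OPTIMAL constraint family: every physical `ψ` `l2`-orthogonal to `φ₀,…,φ_{j−1}` has `⟨ψ,K_βψ⟩ ≤ λ_j ‖ψ‖²` (the domination clause of
Lit `exists_orthonormal_eigenvectors_antitone`, transported through the dictionary).  ORIGINAL DOCSTRING of the attainment part:  For `β ≥ 0` and every level `k` with `λ_k(β,L) > 0` there is a PHYSICAL,
`l2`-ORTHONORMAL family `φ₀, …, φ_k` of EXACT eigenfunctions of the zero-flux transfer operator realising the min–max values: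
`K_β φ_j = λ_j φ_j` pointwise, `λ_j = levelValue su2Rep L β j`.  Proof: Hilbert–Schmidt theorem + min–max over the dense physical core
(Lit `exists_orthonormal_eigenvectors_antitone`, `isGLB_minmax_of_dense_constraints`) for the compression (Lit `exists_compression`) of
the `L²` kernel operator to the (infinite-dimensional, `not_finiteDimensional_physL2`) physical closed subspace; the eigenvalues are
identified with the tree's `levelValue` (Courant–Fischer in `rayleighSet` form, junk values `sSup ∅ = 0` included); the representatives
are the kernel integrals `λ_j⁻¹ ∫ K_β(·,V) e_j(V) dV` (`isPhys_transferApply_coe`). [cite: ReedSimonI1980, Thm. VI.16] [cite: ReedSimonIV1978, Thm. XIII.1–2] -/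
theorem exists_isPhys_eigenfamily_dominating {β : ℝ} (hβ : 0 ≤ β) (k : ℕ) (hk : 0 < levelValue su2Rep L β k) :
    ∃ φ : Fin (k + 1) → (GaugeConfig 3 L SU2 → ℝ),
      (∀ i, IsPhys (φ i)) ∧
      (∀ i l, l2 (φ i) (φ l) = if i = l then 1 else 0) ∧
      (∀ i, transferApply β (φ i) = levelValue su2Rep L β i • φ i) ∧
      (∀ (j : Fin (k + 1)) (ψ : GaugeConfig 3 L SU2 → ℝ), IsPhys ψ → (∀ i : Fin (k + 1), i < j → l2 ψ (φ i) = 0) →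
        qform su2Rep β ψ ψ ≤ levelValue su2Rep L β j * l2 ψ ψ) := by
  classical
  -- the `L²` operator, its compression to the physical closed subspace `V`
  obtain ⟨A, hA, hsa, hc⟩ := exists_transferOpL2 (L := L) β
  haveI : CompleteSpace (physL2 L) := isClosed_physL2.completeSpace_coe
  obtain ⟨T, hT, hTsa, hTc⟩ := exists_compression A (physL2 L) (fun v hv => apply_mem_physL2 hA hv)
  have hTsa' : IsSelfAdjoint T := hTsa hsa
  have hTc' : IsCompactOperator T := hTc hc
  have hTinner : ∀ x : physL2 L, ⟪x, T x⟫_ℝ = ⟪(x : Lp ℝ 2 (configMeasure SU2 L)), A x⟫_ℝ := fun x =>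
    (compression_inner_norm hT x).1
  have hpos : ∀ x : physL2 L, 0 ≤ RCLike.re ⟪x, T x⟫_ℝ := fun x => by
    rw [RCLike.re_to_real, hTinner]
    exact inner_apply_nonneg hA hβ x.2
  have hsym : ∀ x y : physL2 L, ⟪T x, y⟫_ℝ = ⟪x, T y⟫_ℝ := fun x y =>
    (ContinuousLinearMap.isSelfAdjoint_iff_isSymmetric.1 hTsa') x y
  -- the eigenfamily and the min–max principle over the dense core
  obtain ⟨e, ev, hon, heig, hanti, hdom⟩ :=
    exists_orthonormal_eigenvectors_antitone (𝕜 := ℝ) not_finiteDimensional_physL2 hTsa' hTc' hpos (k + 1)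
  have heig' : ∀ j, T (e j) = ev j • e j := fun j => by simpa using heig j
  have hAe : ∀ j, A (e j : Lp ℝ 2 (configMeasure SU2 L)) = ev j • (e j : Lp ℝ 2 (configMeasure SU2 L)) := fun j => by
    rw [← hT, heig', Submodule.coe_smul]
  have hglb := fun j : Fin (k + 1) =>
    isGLB_minmax_of_dense_constraints (𝕜 := ℝ) hsym hpos hon heig hanti hdom (physCoreIn L) dense_physCoreIn j
  -- dictionary on the core
  have hcoreT : ∀ ψ : physSubmodule L, ⟪toV ψ, T (toV ψ)⟫_ℝ = qform su2Rep β (ψ : GaugeConfig 3 L SU2 → ℝ) ψ := fun ψ => by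
    rw [hTinner]; exact inner_apply_toL2 hA ψ ψ
  have hcoreN : ∀ ψ : physSubmodule L, ‖toV ψ‖ ^ 2 = l2 (ψ : GaugeConfig 3 L SU2 → ℝ) ψ := fun ψ => by
    rw [Submodule.coe_norm]; exact norm_sq_toL2 ψ
  have hcoreI : ∀ ψ φ : physSubmodule L, ⟪toV ψ, toV φ⟫_ℝ = l2 (ψ : GaugeConfig 3 L SU2 → ℝ) φ := fun ψ φ => by
    rw [Submodule.coe_inner]; exact inner_toL2 ψ φ
  -- IDENTIFICATION `ev j = levelValue j`
  have hev : ∀ j : Fin (k + 1), ev j = levelValue su2Rep L β j := by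
    intro j
    apply le_antisymm
    · -- `ev j ≤ levelValue j`: every constraint family's constrained supremum is admissible
      unfold levelValue
      refine le_csInf ⟨_, fun _ _ => (1 : ℝ), fun _ => isPhys_const 1, rfl⟩ ?_
      rintro s ⟨φs, hφ, rfl⟩
      refine (hglb j).1 ⟨fun l => toV ⟨φs l, hφ l⟩, fun l => toV_mem_physCoreIn _, fun x hx hperp => ?_⟩
      obtain ⟨ψ, hψx⟩ := mem_physCore_iff.mp (mem_physCoreIn_iff.mp hx)
      have hxψ : x = toV ψ := Subtype.ext hψx.symm
      subst hxψ
      rw [RCLike.re_to_real, hcoreT, hcoreN]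
      have hperp' : ∀ l, l2 (ψ : GaugeConfig 3 L SU2 → ℝ) (φs l) = 0 := fun l => by
        have h := hperp l
        rw [hcoreI] at h
        rw [l2_comm]
        exact h
      rcases (l2_self_nonneg (ψ : GaugeConfig 3 L SU2 → ℝ)).eq_or_lt with h0 | hpos'
      · rw [← h0, mul_zero, qform_eq_zero_of_l2_eq_zero β (isPhys_coe ψ) h0.symm]
      · have hmem : qform su2Rep β (ψ : GaugeConfig 3 L SU2 → ℝ) ψ / l2 (ψ : GaugeConfig 3 L SU2 → ℝ) ψ ∈
            rayleighSet su2Rep L β (fun χ => ∀ i, l2 χ (φs i) = 0) := ⟨ψ, isPhys_coe ψ, hperp', hpos', rfl⟩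
        have hle := le_csSup (bddAbove_rayleighSet su2Rep continuous_su2Rep β _) hmem
        rwa [div_le_iff₀ hpos'] at hle
    · -- `levelValue j ≤ ev j`: admissible values with core constraints approach `ev j`
      refine le_of_forall_pos_lt_add fun ε hε => ?_
      obtain ⟨s, ⟨χ, hχD, hχ⟩, -, hslt⟩ := (hglb j).exists_between (lt_add_of_pos_right _ hε)
      have hχψ : ∀ l, ∃ ψ : physSubmodule L, toV ψ = χ l := fun l => by
        obtain ⟨ψ, hψ⟩ := mem_physCore_iff.mp (mem_physCoreIn_iff.mp (hχD l))
        exact ⟨ψ, Subtype.ext hψ⟩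
      choose ψs hψs using hχψ
      have hφ : ∀ l, IsPhys ((ψs l : physSubmodule L) : GaugeConfig 3 L SU2 → ℝ) := fun l => isPhys_coe _
      have h1 : levelValue su2Rep L β j ≤ sSup (rayleighSet su2Rep L β fun χ' => ∀ i, l2 χ' ((ψs i : physSubmodule L) : _) = 0) := by
        unfold levelValue
        refine csInf_le ⟨0, ?_⟩ ⟨fun i => ((ψs i : physSubmodule L) : GaugeConfig 3 L SU2 → ℝ), hφ, rfl⟩
        rintro t ⟨φs', -, rfl⟩
        refine Real.sSup_nonneg ?_
        rintro r ⟨ψ', hψ', -, hp, rfl⟩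
        exact div_nonneg (qform_su2Rep_self_nonneg hβ hψ') hp.le
      have h2 : sSup (rayleighSet su2Rep L β fun χ' => ∀ i, l2 χ' ((ψs i : physSubmodule L) : _) = 0) ≤ max s 0 := by
        refine Real.sSup_le ?_ (le_max_right _ _)
        rintro r ⟨ψ', hψ', hperp, hp, rfl⟩
        refine (le_max_left s 0).trans' ?_
        rw [div_le_iff₀ hp]
        have hx : toV ⟨ψ', hψ'⟩ ∈ physCoreIn L := toV_mem_physCoreIn _
        have hperpV : ∀ l, ⟪χ l, toV ⟨ψ', hψ'⟩⟫_ℝ = 0 := fun l => by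
          rw [← hψs l, hcoreI, l2_comm]; exact hperp l
        have h := hχ (toV ⟨ψ', hψ'⟩) hx hperpV
        rwa [RCLike.re_to_real, hcoreT, hcoreN] at h
      have h3 : max s 0 < ev j + ε := max_lt hslt (lt_add_of_le_of_pos (ev_nonneg hpos hon heig j) hε)
      linarith
  -- positivity of the first `k+1` eigenvalues
  have hevpos : ∀ j : Fin (k + 1), 0 < ev j := fun j => by
    have h1 : ev (Fin.last k) ≤ ev j := hanti (Fin.le_last j)
    have h2 : ev (Fin.last k) = levelValue su2Rep L β k := by rw [hev, Fin.val_last]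
    rw [h2] at h1
    exact hk.trans_le h1
  -- REPRESENTATIVES: `φ_j := ev_j⁻¹ • K_β e_j`
  set φ : Fin (k + 1) → (GaugeConfig 3 L SU2 → ℝ) := fun j =>
    (ev j)⁻¹ • transferApply β ((e j : Lp ℝ 2 (configMeasure SU2 L)) : GaugeConfig 3 L SU2 → ℝ) with hφdef
  have hKe : ∀ j, IsPhys (transferApply β ((e j : Lp ℝ 2 (configMeasure SU2 L)) : GaugeConfig 3 L SU2 → ℝ)) := fun j =>
    isPhys_transferApply_coe β (e j).2
  have hφphys : ∀ j, IsPhys (φ j) := fun j => (hKe j).smul _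
  -- the class of `φ_j` is `e_j`
  have hclass : ∀ j, toL2 ⟨φ j, hφphys j⟩ = (e j : Lp ℝ 2 (configMeasure SU2 L)) := fun j => by
    have h1 : (⟨φ j, hφphys j⟩ : physSubmodule L) = (ev j)⁻¹ • ⟨_, hKe j⟩ := rfl
    rw [h1, map_smul, toL2_transferApply_coe hA (e j).2, hAe, smul_smul, inv_mul_cancel₀ (hevpos j).ne', one_smul]
  refine ⟨φ, hφphys, fun i l => ?_, fun i => ?_, fun j ψ hψ hperp => ?_⟩
  · -- orthonormality
    rw [show l2 (φ i) (φ l) = l2 ((⟨φ i, hφphys i⟩ : physSubmodule L) : GaugeConfig 3 L SU2 → ℝ) (⟨φ l, hφphys l⟩ : physSubmodule L)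
      from rfl, ← inner_toL2, hclass, hclass, ← Submodule.coe_inner]
    exact (orthonormal_iff_ite.mp hon) i l
  · -- the eigen-equation, pointwise
    have hae : transferApply β ((e i : Lp ℝ 2 (configMeasure SU2 L)) : GaugeConfig 3 L SU2 → ℝ) =ᵐ[configMeasure SU2 L]
        ev i • ((e i : Lp ℝ 2 (configMeasure SU2 L)) : GaugeConfig 3 L SU2 → ℝ) := by
      have h1 := hA (e i : Lp ℝ 2 (configMeasure SU2 L))
      rw [hAe] at h1
      filter_upwards [h1, Lp.coeFn_smul (ev i) (e i : Lp ℝ 2 (configMeasure SU2 L))] with U hU hs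
      rw [transferApply_apply, ← hU, hs]
    have hKK : transferApply β (transferApply β ((e i : Lp ℝ 2 (configMeasure SU2 L)) : GaugeConfig 3 L SU2 → ℝ)) =
        ev i • transferApply β ((e i : Lp ℝ 2 (configMeasure SU2 L)) : GaugeConfig 3 L SU2 → ℝ) := by
      rw [transferApply_congr_ae hae, transferApply_smul]
    rw [← hev]
    show transferApply β ((ev i)⁻¹ • transferApply β _) = ev i • ((ev i)⁻¹ • transferApply β _)
    rw [transferApply_smul, hKK, smul_smul, smul_smul, inv_mul_cancel₀ (hevpos i).ne', mul_inv_cancel₀ (hevpos i).ne']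
  · -- domination, transported: `e i = toV φ_i`, `x = toV ψ`
    have heV : ∀ i, e i = toV ⟨φ i, hφphys i⟩ := fun i => Subtype.ext (by rw [coe_toV, hclass])
    have h := hdom j (toV ⟨ψ, hψ⟩) (fun i hi => by
      rw [heV i, hcoreI]
      show l2 (φ i) ψ = 0
      rw [l2_comm]; exact hperp i hi)
    rw [RCLike.re_to_real, hcoreT, hcoreN, hev] at h
    exact h

end Summit.QuantumFields.YangMills.Theorems.FemtoTransferGap.PhysL2

end
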